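import Summits.AtomisticToContinuum.Crystallization.Theorems.PerronTransitivityFractionalGainGivesTransitivity

/-!
# Crux `TransitiveLocalLimit` (stmt-AtomisticToContinuum-15100): the energetic doors, weakest first

The crux `PerronTransitivity.TransitiveLocalLimit` (an EXACTLY energy-transitive local limit of every
Lennard-Jones ground-state sequence, level `2E*`, `E* = ⨅_Q e_LJ(Q)`) is reached in tree through the landed
composition `TransitiveLocalLimit_of_parts` of line `birth` (stubs 2–4 landed: two-sided concentration ⇒
centred extraction ⇒ continuity of site energies).  This file records, once and for all, the three
successively STRONGER but successively more CHECKABLE energetic hypotheses that feed that composition,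
each as a door `H → TransitiveLocalLimit`:

* `transitiveLocalLimit_of_concentration` — **the weakest energetic door**: two-sided concentration in
  density of the finite-`N` site energies at `2E*` along every ground-state sequence
  (`#{i : θ < |𝓔ⁱ(x N) − 2E*|}/N → 0` for every `θ > 0`) already gives the crux (the one-sided stub 1 of
  the registered line follows from it by `card_superBound_le_card_far`, and stub 2 becomes vacuous);
* `transitiveLocalLimit_of_l2Coercive` — **L²-coercivity of the floor on ground states**:
  `Σᵢ (𝓔ⁱ(x) − 2E*)² ≤ A·(E_LJ(x) − N·E*)` for some constant `A` and every ground state `x` gives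
  two-sided concentration with the rate `A (E(N)/N − E*)/θ²` (Chebyshev + `crysEnergyLimit`), hence the
  crux.  K* on ground states is the case `A = 2(C_δ + 2|E*|)` (landed, `sum_sq_siteEnergy_sub_le_of_copositive`);
* `transitiveLocalLimit_of_sizeBiasedFloor` — **the size-biased floor** (crux idea `size-biased-floor`,
  ideator 2, 2026-08-17): `Σᵢ 𝓔ⁱ(x)² ≤ 2E*·Σᵢ 𝓔ⁱ(x)` on every ground state is, by
  `Σᵢ 𝓔ⁱ = 2E_LJ(x)` (`two_mul_interactionEnergy`), LITERALLY the coercive inequality with `A = −4E*`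
  (`sum_sq_sub_le_of_sizeBiasedFloor`, an identity-level rewriting), hence the crux.  This is the fourth
  modus-ponens door into stmt-15100 besides K* (15098), `BulkDefectVanish` (0751) and `LayeredWindows`
  (11778); its hypothesis is not (yet) a ledger item.

No new mechanism: Chebyshev and the landed composition.  All `[folklore]` given the hypotheses.
-/

noncomputable section

namespace Summit.AtomisticToContinuum.Crystallization.Theorems.TransitiveLocalLimitBirth

open Filter Literature.MathematicalPhysics.StatisticalMechanics
open scoped BigOperators

/-! ## Door 1: two-sided concentration suffices -/

/-- A `θ`-super-bound site (`𝓔ⁱ ≤ 2E − θ`) is `θ/2`-far from `2E`: the one-sided count of stub 1 is at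
most the two-sided count of stub 2 at half the threshold. [folklore] -/
theorem card_superBound_le_card_far {N : ℕ} (x : Fin N → EuclideanSpace ℝ (Fin 3)) (E : ℝ) {θ : ℝ}
    (hθ : 0 < θ) :
    (Finset.univ.filter fun i : Fin N => siteEnergy lennardJones x i ≤ 2 * E - θ).card ≤
      (Finset.univ.filter fun i : Fin N => θ / 2 < |siteEnergy lennardJones x i - 2 * E|).card := by
  refine Finset.card_le_card fun i hi => ?_
  rw [Finset.mem_filter] at hi ⊢
  refine ⟨hi.1, ?_⟩
  have h : θ ≤ 2 * E - siteEnergy lennardJones x i := by linarith [hi.2]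
  rw [abs_sub_comm, abs_of_nonneg (hθ.le.trans h)]
  linarith

/-- **Two-sided concentration ⇒ the registered stub 1** (`stub_superBoundSparse`): if along every
Lennard-Jones ground-state sequence the sites `θ`-far from `2E*` have density `→ 0` for every `θ > 0`, then
so do the `θ`-super-bound sites. [folklore] -/
theorem superBoundSparse_of_concentration
    (hconc : ∀ x : (N : ℕ) → (Fin N → EuclideanSpace ℝ (Fin 3)),
      (∀ N, IsGroundState lennardJones (x N)) → ∀ θ : ℝ, 0 < θ →
        Tendsto (fun N : ℕ => ((Finset.univ.filter fun i : Fin N =>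
          θ < |siteEnergy lennardJones (x N) i -
            2 * (⨅ Q : PeriodicConfiguration 3, Q.energyPerParticle lennardJones)|).card : ℝ) / N)
          atTop (nhds 0))
    (x : (N : ℕ) → (Fin N → EuclideanSpace ℝ (Fin 3))) (hx : ∀ N, IsGroundState lennardJones (x N))
    {θ : ℝ} (hθ : 0 < θ) :
    Tendsto (fun N : ℕ => ((Finset.univ.filter fun i : Fin N =>
      siteEnergy lennardJones (x N) i ≤
        2 * (⨅ Q : PeriodicConfiguration 3, Q.energyPerParticle lennardJones) - θ).card : ℝ) / N)
      atTop (nhds 0) := by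
  have h := hconc x hx (θ / 2) (half_pos hθ)
  refine squeeze_zero' (Eventually.of_forall fun N => by positivity)
    (Eventually.of_forall fun N => ?_) h
  have hle : ((Finset.univ.filter fun i : Fin N => siteEnergy lennardJones (x N) i ≤
      2 * (⨅ Q : PeriodicConfiguration 3, Q.energyPerParticle lennardJones) - θ).card : ℝ) ≤
      ((Finset.univ.filter fun i : Fin N => θ / 2 < |siteEnergy lennardJones (x N) i -
        2 * (⨅ Q : PeriodicConfiguration 3, Q.energyPerParticle lennardJones)|).card : ℝ) := by
    exact_mod_cast card_superBound_le_card_far (x N) _ hθ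
  exact div_le_div_of_nonneg_right hle (Nat.cast_nonneg _)

/-- **DOOR 1 — the weakest energetic door into the crux.** Two-sided concentration in density of the
finite-`N` site energies at `2E*` along every Lennard-Jones ground-state sequence already gives
`TransitiveLocalLimit`: the landed composition `TransitiveLocalLimit_of_parts` with stub 1 supplied by
`superBoundSparse_of_concentration`, stub 2 by the hypothesis itself, and the landed stubs 3–4
(`stub_centredLocalLimit`, `stub_siteEnergyContinuity`). [folklore] -/
theorem transitiveLocalLimit_of_concentration : (∀ x : (N : ℕ) → (Fin N → EuclideanSpace ℝ (Fin 3)), (∀ N, Literature.MathematicalPhysics.StatisticalMechanics.IsGroundState Literature.MathematicalPhysics.StatisticalMechanics.lennardJones (x N)) → ∀ θ : ℝ, 0 < θ → Filter.Tendsto (fun N : ℕ => ((Finset.univ.filter fun i : Fin N => θ < |Literature.MathematicalPhysics.StatisticalMechanics.siteEnergy Literature.MathematicalPhysics.StatisticalMechanics.lennardJones (x N) i - 2 * (⨅ Q : Literature.MathematicalPhysics.StatisticalMechanics.PeriodicConfiguration 3, Q.energyPerParticle Literature.MathematicalPhysics.StatisticalMechanics.lennardJones)|).card : ℝ) / N)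 Filter.atTop (nhds 0)) → ∀ x : (N : ℕ) → (Fin N → EuclideanSpace ℝ (Fin 3)), (∀ N, Literature.MathematicalPhysics.StatisticalMechanics.IsGroundState Literature.MathematicalPhysics.StatisticalMechanics.lennardJones (x N)) → ∃ (X : Set (EuclideanSpace ℝ (Fin 3))) (σ : ℕ → ℕ) (τ : ℕ → EuclideanSpace ℝ (Fin 3)), X.Nonempty ∧ (∃ δ : ℝ, 0 < δ ∧ ∀ p ∈ X, ∀ q ∈ X, p ≠ q → δ ≤ dist p q) ∧ StrictMono σ ∧ (∀ R ε : ℝ, 0 < ε → ∀ᶠ j : ℕ in Filter.atTop, (∀ p ∈ X, ‖p‖ ≤ R → ∃ i : Fin (σ j), dist (x (σ j) i + τ j) p ≤ ε) ∧ (∀ i : Fin (σ j), ‖x (σ j) i + τ j‖ ≤ R → ∃ p ∈ X, dist (x (σ j) i + τ j) p ≤ ε)) ∧ ∀ p ∈ X, ∑' q : {q : EuclideanSpace ℝ (Fin 3) // q ∈ X ∧ q ≠ p}, Literature.MathematicalPhysics.StatisticalMechanics.lennardJones (dist p q.1) = 2 * ⨅ Q : Literature.MathematicalPhysics.StatisticalMechanics.PeriodicConfiguration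 3, Q.energyPerParticle Literature.MathematicalPhysics.StatisticalMechanics.lennardJones :=
  fun hconc => TransitiveLocalLimit_of_parts
    (fun x hx _θ hθ => superBoundSparse_of_concentration hconc x hx hθ)
    (fun x hx _ θ hθ => hconc x hx θ hθ) stub_centredLocalLimit stub_siteEnergyContinuity

/-! ## Door 2: L²-coercivity of the floor on ground states -/

/-- Chebyshev at finite `N`: `θ² · #{i : θ < |𝓔ⁱ − 2E|} ≤ Σᵢ (𝓔ⁱ − 2E)²`. [folklore] -/
theorem sq_mul_card_far_le_sum_sq {N : ℕ} (x : Fin N → EuclideanSpace ℝ (Fin 3)) (E : ℝ) {θ : ℝ}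
    (hθ : 0 < θ) :
    θ ^ 2 * ((Finset.univ.filter fun i : Fin N => θ < |siteEnergy lennardJones x i - 2 * E|).card : ℝ) ≤
      ∑ i, (siteEnergy lennardJones x i - 2 * E) ^ 2 := by
  set F := Finset.univ.filter fun i : Fin N => θ < |siteEnergy lennardJones x i - 2 * E| with hF
  have h1 : θ ^ 2 * (F.card : ℝ) ≤ ∑ i ∈ F, (siteEnergy lennardJones x i - 2 * E) ^ 2 := by
    rw [mul_comm, ← nsmul_eq_mul, ← Finset.sum_const]
    refine Finset.sum_le_sum fun i hi => ?_
    have hi' : θ < |siteEnergy lennardJones x i - 2 * E| := (Finset.mem_filter.1 hi).2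
    have hθi : θ ^ 2 ≤ |siteEnergy lennardJones x i - 2 * E| ^ 2 :=
      pow_le_pow_left₀ hθ.le hi'.le 2
    rwa [sq_abs] at hθi
  exact h1.trans
    (Finset.sum_le_sum_of_subset_of_nonneg (Finset.filter_subset _ _) fun i _ _ => sq_nonneg _)

/-- **L²-coercivity ⇒ two-sided concentration, with a rate.** If for some constant `A` every
Lennard-Jones ground state `x` of `ℝ³` satisfies `Σᵢ (𝓔ⁱ(x) − 2E*)² ≤ A·(E_LJ(x) − N·E*)`, then along every
ground-state sequence `#{i : θ < |𝓔ⁱ(x N) − 2E*|}/N ≤ (A/θ²)(E(N)/N − E*) → 0` (`crysEnergyLimit`).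
[folklore] -/
theorem concentration_of_l2Coercive {A : ℝ}
    (hA : ∀ (N : ℕ) (x : Fin N → EuclideanSpace ℝ (Fin 3)), IsGroundState lennardJones x →
      ∑ i, (siteEnergy lennardJones x i -
        2 * (⨅ Q : PeriodicConfiguration 3, Q.energyPerParticle lennardJones)) ^ 2 ≤
        A * (interactionEnergy lennardJones x -
          N * (⨅ Q : PeriodicConfiguration 3, Q.energyPerParticle lennardJones)))
    (x : (N : ℕ) → (Fin N → EuclideanSpace ℝ (Fin 3))) (hx : ∀ N, IsGroundState lennardJones (x N))
    {θ : ℝ} (hθ : 0 < θ) :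
    Tendsto (fun N : ℕ => ((Finset.univ.filter fun i : Fin N =>
      θ < |siteEnergy lennardJones (x N) i -
        2 * (⨅ Q : PeriodicConfiguration 3, Q.energyPerParticle lennardJones)|).card : ℝ) / N)
      atTop (nhds 0) := by
  set E : ℝ := ⨅ Q : PeriodicConfiguration 3, Q.energyPerParticle lennardJones with hE
  -- the comparison sequence tends to `0`
  have hlim : Tendsto (fun N : ℕ => A / θ ^ 2 * (groundStateEnergy lennardJones 3 N / N - E))
      atTop (nhds 0) := by
    have h :=
      (Summit.AtomisticToContinuum.Crystallization.Theorems.ChargedEnergyGapNegative.crysEnergyLimit).sub_const E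
    rw [sub_self] at h
    simpa using h.const_mul (A / θ ^ 2)
  refine squeeze_zero' (Eventually.of_forall fun N => by positivity) ?_ hlim
  filter_upwards [eventually_ge_atTop 1] with N hN
  have hN : (0 : ℝ) < N := by exact_mod_cast hN
  have hθ2 : 0 < θ ^ 2 := by positivity
  have h1 := sq_mul_card_far_le_sum_sq (x N) E hθ
  have h2 : ∑ i, (siteEnergy lennardJones (x N) i - 2 * E) ^ 2 ≤
      A * (groundStateEnergy lennardJones 3 N - N * E) := by
    rw [← (hx N).2]
    exact hA N (x N) (hx N)
  have h3 : ((Finset.univ.filter fun i : Fin N =>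
      θ < |siteEnergy lennardJones (x N) i - 2 * E|).card : ℝ) ≤
        A / θ ^ 2 * (groundStateEnergy lennardJones 3 N - N * E) := by
    rw [div_mul_eq_mul_div, le_div_iff₀ hθ2, mul_comm]
    exact h1.trans h2
  rw [div_le_iff₀ hN]
  calc ((Finset.univ.filter fun i : Fin N =>
      θ < |siteEnergy lennardJones (x N) i - 2 * E|).card : ℝ)
      ≤ A / θ ^ 2 * (groundStateEnergy lennardJones 3 N - N * E) := h3
    _ = A / θ ^ 2 * (groundStateEnergy lennardJones 3 N / N - E) * N := by
        field_simp

/-- **DOOR 2 — L²-coercivity of the floor on ground states gives the crux**: if for some constant `A`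
every Lennard-Jones ground state `x` of `ℝ³` satisfies `Σᵢ (𝓔ⁱ(x) − 2E*)² ≤ A·(E_LJ(x) − N·E*)`
(`E* = ⨅_Q e_LJ(Q)`), then `TransitiveLocalLimit` (Chebyshev + `crysEnergyLimit` + door 1). K* on ground
states is the instance `A = 2(C_δ + 2|E*|)` (`sum_sq_siteEnergy_sub_le_of_copositive`). [folklore] -/
theorem transitiveLocalLimit_of_l2Coercive : (∃ A : ℝ, ∀ (N : ℕ) (x : Fin N → EuclideanSpace ℝ (Fin 3)), Literature.MathematicalPhysics.StatisticalMechanics.IsGroundState Literature.MathematicalPhysics.StatisticalMechanics.lennardJones x → ∑ i, (Literature.MathematicalPhysics.StatisticalMechanics.siteEnergy Literature.MathematicalPhysics.StatisticalMechanics.lennardJones x i - 2 * (⨅ Q : Literature.MathematicalPhysics.StatisticalMechanics.PeriodicConfiguration 3, Q.energyPerParticle Literature.MathematicalPhysics.StatisticalMechanics.lennardJones)) ^ 2 ≤ A * (Literature.MathematicalPhysics.StatisticalMechanics.interactionEnergy Literature.MathematicalPhysics.StatisticalMechanics.lennardJones x - N * (⨅ Q : Literature.MathematicalPhysics.StatisticalMechanics.PeriodicConfiguration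 3, Q.energyPerParticle Literature.MathematicalPhysics.StatisticalMechanics.lennardJones))) → ∀ x : (N : ℕ) → (Fin N → EuclideanSpace ℝ (Fin 3)), (∀ N, Literature.MathematicalPhysics.StatisticalMechanics.IsGroundState Literature.MathematicalPhysics.StatisticalMechanics.lennardJones (x N)) → ∃ (X : Set (EuclideanSpace ℝ (Fin 3))) (σ : ℕ → ℕ) (τ : ℕ → EuclideanSpace ℝ (Fin 3)), X.Nonempty ∧ (∃ δ : ℝ, 0 < δ ∧ ∀ p ∈ X, ∀ q ∈ X, p ≠ q → δ ≤ dist p q) ∧ StrictMono σ ∧ (∀ R ε : ℝ, 0 < ε → ∀ᶠ j : ℕ in Filter.atTop, (∀ p ∈ X, ‖p‖ ≤ R → ∃ i : Fin (σ j), dist (x (σ j) i + τ j) p ≤ ε) ∧ (∀ i : Fin (σ j), ‖x (σ j) i + τ j‖ ≤ R → ∃ p ∈ X, dist (x (σ j) i + τ j) p ≤ ε)) ∧ ∀ p ∈ X, ∑' q : {q : EuclideanSpace ℝ (Fin 3) // q ∈ X ∧ q ≠ p}, Literature.MathematicalPhysics.StatisticalMechanics.lennardJones (dist p q.1) = 2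 * ⨅ Q : Literature.MathematicalPhysics.StatisticalMechanics.PeriodicConfiguration 3, Q.energyPerParticle Literature.MathematicalPhysics.StatisticalMechanics.lennardJones :=
  fun ⟨_A, hA⟩ => transitiveLocalLimit_of_concentration
    fun x hx _θ hθ => concentration_of_l2Coercive hA x hx hθ

/-! ## Door 3: the size-biased floor on ground states -/

/-- Algebra: `Σᵢ (𝓔ⁱ − 2E)² = Σᵢ 𝓔ⁱ² − 8E·E_LJ(x) + 4E²·N` (`Σᵢ 𝓔ⁱ = 2E_LJ(x)`, `two_mul_interactionEnergy`).
[folklore] -/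
theorem sum_sq_siteEnergy_sub_eq {N : ℕ} (x : Fin N → EuclideanSpace ℝ (Fin 3)) (E : ℝ) :
    ∑ i, (siteEnergy lennardJones x i - 2 * E) ^ 2 =
      ∑ i, siteEnergy lennardJones x i ^ 2 - 8 * E * interactionEnergy lennardJones x + 4 * E ^ 2 * N := by
  have hexp : ∀ i : Fin N, (siteEnergy lennardJones x i - 2 * E) ^ 2 =
      siteEnergy lennardJones x i ^ 2 - 4 * E * siteEnergy lennardJones x i + 4 * E ^ 2 := fun i => by
    ring
  simp only [hexp, Finset.sum_add_distrib, Finset.sum_sub_distrib, ← Finset.mul_sum,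
    Finset.sum_const, Finset.card_univ, Fintype.card_fin, nsmul_eq_mul,
    ← two_mul_interactionEnergy]
  ring

/-- **The size-biased floor is the coercive inequality with `A = −4E`.** On a finite configuration,
`Σᵢ 𝓔ⁱ² ≤ 2E·Σᵢ 𝓔ⁱ` is equivalent to `Σᵢ (𝓔ⁱ − 2E)² ≤ (−4E)·(E_LJ(x) − N·E)`; we record the forward
direction. [folklore] -/
theorem sum_sq_sub_le_of_sizeBiasedFloor {N : ℕ} (x : Fin N → EuclideanSpace ℝ (Fin 3)) {E : ℝ}
    (hSB : ∑ i, siteEnergy lennardJones x i ^ 2 ≤ 2 * E * ∑ i, siteEnergy lennardJones x i) :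
    ∑ i, (siteEnergy lennardJones x i - 2 * E) ^ 2 ≤
      (-4 * E) * (interactionEnergy lennardJones x - N * E) := by
  rw [← two_mul_interactionEnergy] at hSB
  rw [sum_sq_siteEnergy_sub_eq]
  linear_combination hSB

/-- **DOOR 3 — the size-biased floor on ground states gives the crux** (crux idea `size-biased-floor`):
if every Lennard-Jones ground state `x` of `ℝ³` satisfies `Σᵢ 𝓔ⁱ(x)² ≤ 2E*·Σᵢ 𝓔ⁱ(x)` (`E* = ⨅_Q e_LJ(Q)`;
equivalently `Σᵢ |𝓔ⁱ|(|𝓔ⁱ| − 2|E*|) ≤ 0`: sampling a site with probability proportional to its binding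
does not beat the crystal level), then `TransitiveLocalLimit`.  Door 2 with `A = −4E*`. [folklore] -/
theorem transitiveLocalLimit_of_sizeBiasedFloor : (∀ (N : ℕ) (x : Fin N → EuclideanSpace ℝ (Fin 3)), Literature.MathematicalPhysics.StatisticalMechanics.IsGroundState Literature.MathematicalPhysics.StatisticalMechanics.lennardJones x → ∑ i, Literature.MathematicalPhysics.StatisticalMechanics.siteEnergy Literature.MathematicalPhysics.StatisticalMechanics.lennardJones x i ^ 2 ≤ 2 * (⨅ Q : Literature.MathematicalPhysics.StatisticalMechanics.PeriodicConfiguration 3, Q.energyPerParticle Literature.MathematicalPhysics.StatisticalMechanics.lennardJones) * ∑ i, Literature.MathematicalPhysics.StatisticalMechanics.siteEnergy Literature.MathematicalPhysics.StatisticalMechanics.lennardJones x i) → ∀ x : (N : ℕ) → (Fin N → EuclideanSpace ℝ (Fin 3)), (∀ N, Literature.MathematicalPhysics.StatisticalMechanics.IsGroundState Literature.MathematicalPhysics.StatisticalMechanics.lennardJones (x N)) → ∃ (X : Set (EuclideanSpace ℝ (Fin 3))) (σ : ℕ → ℕ) (τ : ℕ → EuclideanSpace ℝ (Fin 3)), X.Nonempty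 ∧ (∃ δ : ℝ, 0 < δ ∧ ∀ p ∈ X, ∀ q ∈ X, p ≠ q → δ ≤ dist p q) ∧ StrictMono σ ∧ (∀ R ε : ℝ, 0 < ε → ∀ᶠ j : ℕ in Filter.atTop, (∀ p ∈ X, ‖p‖ ≤ R → ∃ i : Fin (σ j), dist (x (σ j) i + τ j) p ≤ ε) ∧ (∀ i : Fin (σ j), ‖x (σ j) i + τ j‖ ≤ R → ∃ p ∈ X, dist (x (σ j) i + τ j) p ≤ ε)) ∧ ∀ p ∈ X, ∑' q : {q : EuclideanSpace ℝ (Fin 3) // q ∈ X ∧ q ≠ p}, Literature.MathematicalPhysics.StatisticalMechanics.lennardJones (dist p q.1) = 2 * ⨅ Q : Literature.MathematicalPhysics.StatisticalMechanics.PeriodicConfiguration 3, Q.energyPerParticle Literature.MathematicalPhysics.StatisticalMechanics.lennardJones :=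
  fun hSB => transitiveLocalLimit_of_l2Coercive
    ⟨-4 * ⨅ Q : PeriodicConfiguration 3, Q.energyPerParticle lennardJones,
      fun N x hx => sum_sq_sub_le_of_sizeBiasedFloor x (hSB N x hx)⟩

end Summit.AtomisticToContinuum.Crystallization.Theorems.TransitiveLocalLimitBirth

end
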